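import Mathlib
import HarnessLib
import Summits.NavierStokesRegularity.NavierStokesRegularity.Theorems.ChiralWindowDoorDefs
import Summits.NavierStokesRegularity.NavierStokesRegularity.Theorems.CriticalFluxDoorDefs
import Summits.NavierStokesRegularity.NavierStokesRegularity.Theorems.ChiralWindowDoorZoomCommutes
import Summits.NavierStokesRegularity.NavierStokesRegularity.Theorems.ChiralWindowDoorBinderFree
import Summits.NavierStokesRegularity.NavierStokesRegularity.Theorems.ChiralWindowDoorLocalPointZoomLambdaSlices
import Summits.NavierStokesRegularity.NavierStokesRegularity.Theorems.ChiralWindowDoorTarget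
import Summits.NavierStokesRegularity.NavierStokesRegularity.Theorems.PlaneStrainDoorZoomSpaceTimeDecay

/-!
# Door S21-C «CriticalFluxDoor» (nsreg-p1 ROUND-20, design-only) — THE ZOOM CRUX K1 `LocalPointZoomFluxWindow` PROVED

Door S21-C of nsreg-p1's local Type-I door family (`HOME/ns-regularity-ideate-p1/ROUND-20.md`, texts `r20/Sketch21v3.lean`;
DESIGN-ONLY, route NOT born).  K1: at a locally space–time Type-I point whose scale-normalised local `Ḣ^{1/2}`-flux density
`√(T−t)⁵ |Φ(u(t))(x₀ + √(T−t)y)|`, `Φ(u) = ⟪Λu, (u·∇)u⟫`, fades in `L¹` on one similarity window, a non-backward-bounded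
point zooms to a door-class profile, backward-singular at the apex and FLUX-FREE on an open window of every slice.  The
functional is NON-LOCAL through `Λ`: the zoom is S20's `…ChiralWindowDoorLocalPointZoomLambdaSlices.localPointZoomVelGradLambdaSlices`
(velocities, gradients AND `Λ` of the slices converge along one sequence — three-zone argument), the glue is the window
Fatou step with the product scalar `⟪(λ²/ν)Λu, ((λ²/ν)Du)((λ/ν)u)⟫ = (λ⁵/ν³)Φ(u)`, `√(T−t)⁵ = σ⁵ν³·λ⁵/ν³`.

* `windowFatou_flux` — the window glue: fading ⇒ `Φ(v s)(σ • y) = 0` for `y ∈ U` (`σ = √(−s)/√ν`);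
* `localPointZoomFluxWindow` — **crux K1 (rank 3) `LocalPointZoomFluxWindow` of `r20/Sketch21v3.lean`, text VERBATIM over
  the tree substrates (`…ChiralWindowDoorDefs.fracLapHalf`, `…CriticalFluxDoorDefs.fluxDensity`), PROVED**.

S21-C NET: K1 ✓ (here), F1 ✓ (`…CriticalFluxDoorCritEnergyLower`), F4 ✓ in class form (`…SobolevFatouOfClass`), F5 ✓
(`…BinderFree.essLocalClass_of_class`), spread ✓ (`…CriticalFluxDoorFluxSpread`); OPEN: F2, F3 (the windowed `Ḣ^{1/2}`
budget) — i.e. S21-C = door modulo its residue budget.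

Seat nsreg-p6 g12 (THEOREMS-ONLY door sequels, DIRECTOR-NS g8 #32 (2)/#36); texts by nsreg-p1 g17/g18.  WHAT THIS IS
NOT: not NS regularity (Clay A); not K2 of S21-C; a blow-up/compactness lemma; no route is opened.
-/

noncomputable section

-- the summit and its single sub-problem share the name (CONVENTIONS §1), as in every Theorems file
set_option linter.dupNamespace false

namespace Summit.NavierStokesRegularity.NavierStokesRegularity.Theorems.CriticalFluxDoorLocalPointZoomFluxWindow

open MeasureTheory Set Function Filter Topology TopologicalSpace Metric
open scoped RealInnerProductSpace InnerProductSpace NNReal ENNReal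
open Literature.Analysis Literature.Analysis.FluidPDE
open Summit.NavierStokesRegularity.NavierStokesRegularity.Theorems.ChiralWindowDoorDefs
open Summit.NavierStokesRegularity.NavierStokesRegularity.Theorems.CriticalFluxDoorDefs
open Summit.NavierStokesRegularity.NavierStokesRegularity.Theorems.ChiralWindowDoorZoomCommutes (fracLapHalf_smul_stPull)
open Summit.NavierStokesRegularity.NavierStokesRegularity.Theorems.ChiralWindowDoorBinderFree (continuous_fracLapHalf_of_class)
open Summit.NavierStokesRegularity.NavierStokesRegularity.Theorems.ChiralWindowDoorLocalPointZoomLambdaSlices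
  (localPointZoomVelGradLambdaSlices)
open Summit.NavierStokesRegularity.NavierStokesRegularity.Theorems.ChiralWindowDoorTarget
  (energy_bound_of_isLerayHopfOn stronglyMeasurable_fracLapHalf)
open Summit.NavierStokesRegularity.NavierStokesRegularity.Theorems.PlaneStrainDoorZoomSpaceTimeDecay
  (hasTypeIDecay_of_zoom timeTypeI_of_spaceTimeTypeI)
open Summit.NavierStokesRegularity.NavierStokesRegularity.Theorems.LocalSineTubeDoorProfileAlignedWindowRigidityAncient
  (analyticOnNhd_slice bdd_of_hasTypeITimeDecay)

/-- **Window glue (Fatou on one similarity window) for the flux density.**  Along zoom data at `x₀` in the sense of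
`localPointZoomVelGradLambdaSlices` (velocities, gradients and `Λ` of the slices converge pointwise to those of a
door-class profile `v`), if the window scalar `√(T−t)⁵|Φ(u(t))(x₀ + √(T−t)y)|` fades in `L¹(U)` as `t → T⁻`, then for
every `s < 0` and `y ∈ U`: `Φ(v s)(σ • y) = 0`, `σ = √(−s)/√ν`. -/
theorem windowFatou_flux {ν T : ℝ} (hν : 0 < ν) (hT : 0 < T)
    {u : ℝ → EuclideanSpace ℝ (Fin 3) → EuclideanSpace ℝ (Fin 3)} {p : ℝ → EuclideanSpace ℝ (Fin 3) → ℝ}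
    (hcl : IsClassicalNSSolutionOn (Ico 0 T) ν 0 u p) {x₀ : EuclideanSpace ℝ (Fin 3)}
    {C D : ℝ} {v : ℝ → EuclideanSpace ℝ (Fin 3) → EuclideanSpace ℝ (Fin 3)} {lam : ℕ → ℝ}
    (hlam : ∀ j, 0 < lam j) (hlam0 : Tendsto lam atTop (𝓝 0))
    (hrate : HasTypeITimeDecay C v) (hdecay : HasTypeIDecay D v) (hcont : ContinuousOn (uncurry v) (Iio (0 : ℝ) ×ˢ univ))
    (hmild : ∀ s t : ℝ, s < t → t < 0 → ∀ x,
      v t x = UnboundedOperators.heatExtension (v s) (t - s) x - oseenDuhamel 1 s v v t x)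
    (hdiv : ∀ t < 0, VectorCalculus.IsDivFree (v t))
    (hconv : ∀ s < 0, ∀ y,
      Tendsto (fun j => (lam j / ν) • u (T + lam j ^ 2 * s / ν) (x₀ + lam j • y)) atTop (𝓝 (v s y)) ∧
      Tendsto (fun j => (lam j ^ 2 / ν) • fderiv ℝ (u (T + lam j ^ 2 * s / ν)) (x₀ + lam j • y)) atTop
        (𝓝 (fderiv ℝ (v s) y)) ∧
      Tendsto (fun j => fracLapHalf (fun y' => (lam j / ν) • u (T + lam j ^ 2 * s / ν) (x₀ + lam j • y')) y)
        atTop (𝓝 (fracLapHalf (v s) y)))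
    {U : Set (EuclideanSpace ℝ (Fin 3))} (hU : IsOpen U)
    (hfade : Tendsto (fun t => ∫⁻ y in U, ENNReal.ofReal (Real.sqrt (T - t) ^ 5 *
      |fluxDensity (u t) (x₀ + Real.sqrt (T - t) • y)|)) (𝓝[<] T) (𝓝 0))
    {s : ℝ} (hs : s < 0) {y : EuclideanSpace ℝ (Fin 3)} (hy : y ∈ U) :
    fluxDensity (v s) ((Real.sqrt (-s) / Real.sqrt ν) • y) = 0 := by
  -- ## zoom times `tⱼ = T + λⱼ² s/ν → T⁻`
  have hns : 0 < -s := neg_pos.2 hs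
  obtain ⟨t, ht⟩ : ∃ t : ℕ → ℝ, ∀ j, t j = T + lam j ^ 2 * s / ν := ⟨_, fun j => rfl⟩
  have hTt : ∀ j, T - t j = lam j ^ 2 * (-s) / ν := fun j => by rw [ht j]; ring
  have hc : ∀ j, 0 < lam j ^ 2 * (-s) / ν := fun j => div_pos (mul_pos (pow_pos (hlam j) 2) hns) hν
  have hc0 : Tendsto (fun j => lam j ^ 2 * (-s) / ν) atTop (𝓝 0) := by
    simpa using ((hlam0.pow 2).mul_const (-s)).div_const ν
  have htT : Tendsto t atTop (𝓝[<] T) := by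
    refine tendsto_nhdsWithin_iff.2 ⟨?_, Eventually.of_forall fun j => ?_⟩
    · have h1 : Tendsto (fun j => T - lam j ^ 2 * (-s) / ν) atTop (𝓝 (T - 0)) :=
        tendsto_const_nhds.sub hc0
      rw [sub_zero] at h1
      refine h1.congr fun j => ?_
      rw [ht j]; ring
    · show t j < T
      have h1 := hc j
      rw [← hTt j] at h1
      linarith
  have hev : ∀ᶠ j in atTop, t j ∈ Set.Ioo 0 T := htT.eventually (Ioo_mem_nhdsLT hT)
  obtain ⟨j₀, hj₀⟩ := eventually_atTop.1 hev
  have hshift : Tendsto (fun j : ℕ => j + j₀) atTop atTop := tendsto_add_atTop_nat j₀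
  -- the window scalars along the shifted zoom times (named, to keep terms small)
  obtain ⟨Φ, hΦ⟩ : ∃ Φ : ℕ → EuclideanSpace ℝ (Fin 3) → ℝ, ∀ j y, Φ j y = Real.sqrt (T - t (j + j₀)) ^ 5 *
      |fluxDensity (u (t (j + j₀))) (x₀ + Real.sqrt (T - t (j + j₀)) • y)| := ⟨_, fun _ _ => rfl⟩
  have hfadej : Tendsto (fun j => ∫⁻ y in U, ENNReal.ofReal (Φ j y)) atTop (𝓝 0) := by
    have h := (hfade.comp htT).comp hshift
    simpa only [Function.comp_def, hΦ] using h
  -- ## the similarity scale along the zoom: `√(T − tⱼ) = λⱼ σ`, `σ = √(−s)/√ν`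
  set σ : ℝ := Real.sqrt (-s) / Real.sqrt ν with hσ
  have hσpos : 0 < σ := div_pos (Real.sqrt_pos.2 hns) (Real.sqrt_pos.2 hν)
  have hsq : ∀ j, Real.sqrt (T - t j) = lam j * σ := by
    intro j
    rw [hTt j, hσ, Real.sqrt_div' _ hν.le, Real.sqrt_mul (pow_nonneg (hlam j).le 2),
      Real.sqrt_sq (hlam j).le]
    ring
  have hTt' : ∀ j, T - t j = σ ^ 2 * ν * (lam j ^ 2 / ν) := by
    intro j
    rw [hTt j, hσ, div_pow, Real.sq_sqrt hns.le, Real.sq_sqrt hν.le]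
    field_simp
  -- the scale factor: `√(T − tⱼ)⁵ = σ⁵ν³ · (λⱼ²/ν)(λⱼ²/ν)(λⱼ/ν)`
  have hpow : ∀ j, Real.sqrt (T - t j) ^ 5 = σ ^ 5 * ν ^ 3 * ((lam j ^ 2 / ν) * ((lam j ^ 2 / ν) * (lam j / ν))) := by
    intro j
    rw [hsq j]
    field_simp
  -- window `Λ` at time `tⱼ` versus `Λ` of the rescaled slice at `σ y`
  have hL : ∀ (j : ℕ) (y : EuclideanSpace ℝ (Fin 3)),
      (lam (j + j₀) ^ 2 / ν) • fracLapHalf (u (t (j + j₀))) (x₀ + Real.sqrt (T - t (j + j₀)) • y) =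
        fracLapHalf (fun y' => (lam (j + j₀) / ν) • u (T + lam (j + j₀) ^ 2 * s / ν)
          (x₀ + lam (j + j₀) • y')) (σ • y) := by
    intro j y
    have hz := fracLapHalf_smul_stPull (lam (j + j₀) / ν) (lam (j + j₀) ^ 2 / ν) (lam (j + j₀)) T
      (hlam (j + j₀)) x₀ u s (σ • y)
    have e1 : ((lam (j + j₀) / ν) • stPull (lam (j + j₀) ^ 2 / ν) (lam (j + j₀)) T x₀ u) s =
        fun y' => (lam (j + j₀) / ν) • u (T + lam (j + j₀) ^ 2 * s / ν) (x₀ + lam (j + j₀) • y') := by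
      funext y'
      rw [smul_stPull_apply]
      congr 2
      ring
    have e2 : T + lam (j + j₀) ^ 2 / ν * s = t (j + j₀) := by rw [ht]; ring
    rw [e1, e2, smul_smul] at hz
    rw [hsq (j + j₀), hz]
    congr 1
    ring
  -- ## the limit scalar in window coordinates and its continuity
  have han : AnalyticOnNhd ℝ (v s) univ := analyticOnNhd_slice hcont (bdd_of_hasTypeITimeDecay hrate) hmild hs
  have hvc : Continuous (v s) := by rw [← continuousOn_univ]; exact han.continuousOn
  have hDvc : Continuous (fderiv ℝ (v s)) := (han.contDiff (n := 1)).continuous_fderiv one_ne_zero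
  have hΛc : Continuous (fracLapHalf (v s)) := continuous_fracLapHalf_of_class hrate hdecay hcont hmild hdiv hs
  obtain ⟨Hs, hHs⟩ : ∃ Hs : EuclideanSpace ℝ (Fin 3) → ℝ, ∀ y,
      Hs y = σ ^ 5 * ν ^ 3 * |fluxDensity (v s) (σ • y)| := ⟨_, fun _ => rfl⟩
  have hΦc : Continuous fun y : EuclideanSpace ℝ (Fin 3) => fluxDensity (v s) (σ • y) := by
    have h1 : Continuous fun y : EuclideanSpace ℝ (Fin 3) => fracLapHalf (v s) (σ • y) := hΛc.comp (continuous_const_smul σ)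
    have h2 : Continuous fun y : EuclideanSpace ℝ (Fin 3) => fderiv ℝ (v s) (σ • y) (v s (σ • y)) :=
      (hDvc.comp (continuous_const_smul σ)).clm_apply (hvc.comp (continuous_const_smul σ))
    exact (h1.inner h2).congr fun y => (fluxDensity_eq _ _).symm
  have hHscont : Continuous Hs := by
    have h := (hΦc.abs).const_mul (σ ^ 5 * ν ^ 3)
    exact h.congr fun y => (hHs y).symm
  -- ## pointwise convergence of the window scalars
  have hconvH : ∀ y, Tendsto (fun j => Φ j y) atTop (𝓝 (Hs y)) := by
    intro y
    have hv := ((hconv s hs (σ • y)).1).comp hshift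
    have hg := ((hconv s hs (σ • y)).2.1).comp hshift
    have hl := ((hconv s hs (σ • y)).2.2).comp hshift
    have hprod : Tendsto (fun j => ⟪fracLapHalf (fun y' => (lam (j + j₀) / ν) • u (T + lam (j + j₀) ^ 2 * s / ν)
        (x₀ + lam (j + j₀) • y')) (σ • y), ((lam (j + j₀) ^ 2 / ν) • fderiv ℝ (u (T + lam (j + j₀) ^ 2 * s / ν))
        (x₀ + lam (j + j₀) • (σ • y))) ((lam (j + j₀) / ν) • u (T + lam (j + j₀) ^ 2 * s / ν)
        (x₀ + lam (j + j₀) • (σ • y)))⟫) atTop (𝓝 ⟪fracLapHalf (v s) (σ • y), fderiv ℝ (v s) (σ • y) (v s (σ • y))⟫) := by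
      have happ := ((ContinuousLinearMap.apply ℝ (EuclideanSpace ℝ (Fin 3))).continuous₂.tendsto _).comp
        (hv.prodMk_nhds hg)
      simp only [Function.comp_def, ContinuousLinearMap.apply_apply] at happ
      exact hl.inner happ
    have h := ((continuous_abs.tendsto _).comp hprod).const_mul (σ ^ 5 * ν ^ 3)
    rw [← fluxDensity_eq, ← hHs] at h
    refine h.congr fun j => ?_
    -- identify the window scalar at `tⱼ` with the rescaled product
    have ex : x₀ + lam (j + j₀) • (σ • y) = x₀ + Real.sqrt (T - t (j + j₀)) • y := by
      rw [hsq (j + j₀), mul_smul]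
    rw [Function.comp_apply, hΦ, fluxDensity_eq, ← hL j y, map_smul, smul_apply,
      ex, ← ht (j + j₀), real_inner_smul_left, real_inner_smul_right, real_inner_smul_right, hpow (j + j₀)]
    simp only [abs_mul, abs_div, abs_pow, abs_of_pos (hlam (j + j₀)), abs_of_pos hν]
    ring
  -- measurability of the window scalars
  have hmem : ∀ j, t (j + j₀) ∈ Set.Ico 0 T := fun j =>
    ⟨(hj₀ (j + j₀) (Nat.le_add_left _ _)).1.le, (hj₀ (j + j₀) (Nat.le_add_left _ _)).2⟩
  have hφ : ∀ j, Continuous fun y : EuclideanSpace ℝ (Fin 3) => x₀ + Real.sqrt (T - t (j + j₀)) • y :=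
    fun j => continuous_const.add (continuous_const_smul _)
  have hFjm : ∀ j, AEStronglyMeasurable (Φ j) volume := by
    intro j
    have hu : Continuous (u (t (j + j₀))) := (hcl.contDiff_velocity (hmem j)).continuous
    have hDu : Continuous (fderiv ℝ (u (t (j + j₀)))) := (hcl.contDiff_velocity (hmem j)).continuous_fderiv (by norm_cast)
    have h1 : AEStronglyMeasurable (fun y => fderiv ℝ (u (t (j + j₀))) (x₀ + Real.sqrt (T - t (j + j₀)) • y)
        (u (t (j + j₀)) (x₀ + Real.sqrt (T - t (j + j₀)) • y))) volume :=
      ((hDu.comp (hφ j)).clm_apply (hu.comp (hφ j))).aestronglyMeasurable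
    have h2 : AEStronglyMeasurable (fun y => fracLapHalf (u (t (j + j₀))) (x₀ + Real.sqrt (T - t (j + j₀)) • y)) volume :=
      ((stronglyMeasurable_fracLapHalf hu).comp_measurable (hφ j).measurable).aestronglyMeasurable
    have h3 : AEStronglyMeasurable (fun y => ⟪fracLapHalf (u (t (j + j₀))) (x₀ + Real.sqrt (T - t (j + j₀)) • y),
        fderiv ℝ (u (t (j + j₀))) (x₀ + Real.sqrt (T - t (j + j₀)) • y)
          (u (t (j + j₀)) (x₀ + Real.sqrt (T - t (j + j₀)) • y))⟫) volume := h2.inner h1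
    have h := (h3.norm).const_mul (Real.sqrt (T - t (j + j₀)) ^ 5)
    refine h.congr (Eventually.of_forall fun y => ?_)
    simp only [hΦ, fluxDensity_eq, Real.norm_eq_abs]
  -- ## FATOU: the faded scalar vanishes on the window in the limit
  set g : EuclideanSpace ℝ (Fin 3) → ℝ≥0∞ := fun y => ENNReal.ofReal (Hs y) with hg
  have hgc : Continuous g := ENNReal.continuous_ofReal.comp hHscont
  have hptw : ∀ y, Tendsto (fun j => ENNReal.ofReal (Φ j y)) atTop (𝓝 (g y)) :=
    fun y => ENNReal.tendsto_ofReal (hconvH y)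
  have hFatou : ∫⁻ y in U, liminf (fun j => ENNReal.ofReal (Φ j y)) atTop ≤
      liminf (fun j => ∫⁻ y in U, ENNReal.ofReal (Φ j y)) atTop :=
    lintegral_liminf_le' fun j => (ENNReal.measurable_ofReal.comp_aemeasurable (hFjm j).aemeasurable).restrict
  have hlim : (fun y => liminf (fun j => ENNReal.ofReal (Φ j y)) atTop) = g :=
    funext fun y => (hptw y).liminf_eq
  rw [hlim, hfadej.liminf_eq] at hFatou
  have hint : ∫⁻ y in U, g y = 0 := le_antisymm hFatou bot_le
  have hae : ∀ᵐ y ∂(volume.restrict U), g y = 0 := (lintegral_eq_zero_iff hgc.measurable).1 hint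
  rw [ae_restrict_iff' hU.measurableSet] at hae
  have hzero : ∀ y ∈ U, g y = 0 := by
    intro y hy
    by_contra hne
    set O : Set (EuclideanSpace ℝ (Fin 3)) := U ∩ g ⁻¹' (Ioi 0) with hO
    have hOo : IsOpen O := hU.inter (isOpen_Ioi.preimage hgc)
    have hO0 : volume O = 0 := by
      rw [measure_eq_zero_iff_ae_notMem]
      filter_upwards [hae] with y' hy'
      rintro ⟨h1, h2⟩
      have := hy' h1
      simp only [mem_preimage, mem_Ioi, this, lt_self_iff_false] at h2
    have hOe : O = ∅ := (hOo.measure_eq_zero_iff volume).1 hO0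
    have hyO : y ∈ O := ⟨hy, by simpa [mem_preimage, mem_Ioi, pos_iff_ne_zero] using hne⟩
    rw [hOe] at hyO
    exact hyO
  have h := hzero y hy
  simp only [hg, ENNReal.ofReal_eq_zero] at h
  have h0 : Hs y = 0 := le_antisymm h (by rw [hHs]; positivity)
  rw [hHs, mul_eq_zero] at h0
  rcases h0 with h0 | h0
  · exfalso
    have : 0 < σ ^ 5 * ν ^ 3 := by positivity
    exact this.ne' h0
  · exact abs_eq_zero.1 h0


/-! ### K1 -/

/-- **Crux K1 (rank 3) `LocalPointZoomFluxWindow` of nsreg-p1 `r20/Sketch21v3.lean` (text verbatim over the tree substrates),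
PROVED.** -/
theorem localPointZoomFluxWindow : ∀ (ν T : ℝ), 0 < ν → 0 < T → ∀ (u : ℝ → EuclideanSpace ℝ (Fin 3) → EuclideanSpace ℝ (Fin 3)) (p : ℝ → EuclideanSpace ℝ (Fin 3) → ℝ), Literature.Analysis.FluidPDE.IsClassicalNSSolutionOn (Set.Ico 0 T) ν 0 u p → Literature.Analysis.FluidPDE.IsLerayHopfOn T ν 0 (u 0) u → Literature.Analysis.FluidPDE.HasRapidSpatialDecay (u 0) → ∀ (x₀ : EuclideanSpace ℝ (Fin 3)) (ρ M : ℝ), 0 < ρ → (∀ t ∈ Set.Ico 0 T, T - ρ ^ 2 < t → ∀ x ∈ Metric.ball x₀ ρ, ‖u t x‖ * (‖x - x₀‖ + Real.sqrt (ν * (T - t))) ≤ M) → ∀ (U : Set (EuclideanSpace ℝ (Fin 3))), IsOpen U → U.Nonempty → Filter.Tendsto (fun t => ∫⁻ y in U, ENNReal.ofReal (Real.sqrt (T - t) ^ 5 * |fluxDensity (u t) (x₀ + Real.sqrt (T - t) • y)|)) (nhdsWithin T (Set.Iio T)) (nhds 0) → ¬ Literature.Analysis.FluidPDE.IsBackwardBoundedAt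 u T x₀ → ∃ (C D : ℝ) (v : ℝ → EuclideanSpace ℝ (Fin 3) → EuclideanSpace ℝ (Fin 3)), Literature.Analysis.FluidPDE.HasTypeITimeDecay C v ∧ Literature.Analysis.FluidPDE.HasTypeIDecay D v ∧ ContinuousOn (Function.uncurry v) (Set.Iio (0 : ℝ) ×ˢ Set.univ) ∧ (∀ s t : ℝ, s < t → t < 0 → ∀ x, v t x = Literature.Analysis.UnboundedOperators.heatExtension (v s) (t - s) x - Literature.Analysis.FluidPDE.oseenDuhamel 1 s v v t x) ∧ (∀ t < 0, Literature.Analysis.FluidPDE.VectorCalculus.IsDivFree (v t)) ∧ Literature.Analysis.FluidPDE.IsBackwardSingularPoint v 0 ∧ (∀ s < 0, ∃ U : Set (EuclideanSpace ℝ (Fin 3)), IsOpen U ∧ U.Nonempty ∧ ∀ z ∈ U, fluxDensity (v s) z = 0) := by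
  intro ν T hν hT u p hcl hLH hdec x₀ ρ M hρ hM U hU hUne hfade hnot
  have hEn := energy_bound_of_isLerayHopfOn hν hLH
  obtain ⟨C, v, lam, hlam, hlam0, ⟨hrate, hcont, hmild, hdiv⟩, hsing, hconv⟩ :=
    localPointZoomVelGradLambdaSlices hν hT hcl hLH hEn hρ (timeTypeI_of_spaceTimeTypeI hM) hnot
  have hdecay : HasTypeIDecay (M / ν) v :=
    hasTypeIDecay_of_zoom hν hT hρ hlam hlam0 hM fun s hs y => (hconv s hs y).1
  refine ⟨C, M / ν, v, hrate, hdecay, hcont, hmild, hdiv, hsing, fun s hs => ?_⟩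
  have hns : 0 < -s := neg_pos.2 hs
  set σ : ℝ := Real.sqrt (-s) / Real.sqrt ν with hσ
  have hσpos : 0 < σ := div_pos (Real.sqrt_pos.2 hns) (Real.sqrt_pos.2 hν)
  refine ⟨(fun z => σ⁻¹ • z) ⁻¹' U, hU.preimage (continuous_const_smul σ⁻¹), ?_, fun z hz => ?_⟩
  · obtain ⟨u₀, hu₀⟩ := hUne
    refine ⟨σ • u₀, ?_⟩
    show σ⁻¹ • (σ • u₀) ∈ U
    rwa [smul_smul, inv_mul_cancel₀ hσpos.ne', one_smul]
  · have h := windowFatou_flux hν hT hcl hlam hlam0 hrate hdecay hcont hmild hdiv hconv hU hfade hs hz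
    rwa [smul_smul, mul_inv_cancel₀ hσpos.ne', one_smul] at h

end Summit.NavierStokesRegularity.NavierStokesRegularity.Theorems.CriticalFluxDoorLocalPointZoomFluxWindow

end
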